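import Summits.MatrixMultiplication.MatrixMultiplication.Theses.IrreducibleSublevelSets

/-!
# Birth skeleton (BC3) for the crux `SublevelIrreducible` — the FINITE-LEVEL line

Crux item `stmt-MatrixMultiplication-19017` of route `route-MatrixMultiplication-IrreducibleSublevelSets`:
`SublevelIrreducible : ∀ a b c (r : ℝ), 0 ≤ r → (vanishingIdeal ℂ {x | R̃(x) ≤ r}).IsPrime`
(every sublevel set `Z_r(a,b,c) = {T ∈ ℂ^{a×b×c} : R̃(T) ≤ r}` of the asymptotic rank is
irreducible; CHNVZ arXiv:2411.15789 §5, printed open question).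

LINE (transfer to a finite Kronecker level).  Two PROVABLE structure stubs turn `Z_r` into a
rank-sublevel set of ONE Kronecker power map, and the open core is stated at that finite level:

* `stub_valueGap` (provable, M/L) — the values of `R̃` on a fixed format are well-ordered: above
  every `r` there is a gap `(r, r')` containing no value.  [CHNVZ Thm 1.2 in tree
  (`chnvz_zariskiClosed_asymptoticRank_le_holds`: `Z_v = zeroLocus (I(Z_v))`) + Hilbert basis
  theorem (`MvPolynomial` over `ℂ` is Noetherian, Mathlib `set_has_maximal_iff_noetherian`):
  a strictly decreasing sequence of values would give a strictly increasing chain of vanishing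
  ideals.]
* `stub_uniformRate` (provable, L) — UNIFORM convergence on a sublevel set: for `r < r'` and any
  `N₁` there is `N ≥ max N₁ 1` with `R(T^{⊠N}) < r'^N` for EVERY `T` with `R̃(T) ≤ r`.
  [The tree's CHNVZ Thm 2.2 argument (`exists_eq_sum_smul_kroneckerPow`,
  `exists_const_tensorRank_kroneckerPow_le`, `tensorRank_kroneckerPow_mul_le_of_eq_sum`,
  `exists_pow_succ_lt_pow`, `exists_le_pow_of_one_lt`) run with `A = Z_r`: the spanning tensors
  `S_i ∈ Z_r` of `span Z_r^{⊠n}` are fixed once `n` is, so the double-blocking bound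
  `R(T^{⊠nm}) ≤ ν(n)^m (∏ C_i) ρ^{nm}` is uniform in `T ∈ Z_r`; take `N = n m`, `m` large.]
* `stub_powerRankLocusPrime` (OPEN core) — for every format and threshold base `s > 0`, for all
  sufficiently large `N`, the rank-sublevel locus of the `N`-th Kronecker power map
  `X_{N,s} = {T : R(T^{⊠N}) < s^N}` has prime vanishing ideal (irreducible Zariski closure).
  `N = 1` is the irreducibility of secant varieties (classical); via the two structure stubs it
  implies the crux (`SublevelIrreducible_of` below), and conversely the crux + the route's proved
  bridge (finitely many values per format) give it back — an honest finite-level REFORMULATION,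
  not a weakening: what it exposes is that `X_{N,s}` is the projection of an explicit incidence
  variety `{(T, u, v, w) : T^{⊠N} = Σ_{i<k} u_i ⊗ v_i ⊗ w_i}` / the preimage of a rank locus under
  the polynomial map `T ↦ T^{⊠N}`, so classical irreducibility tools (images of irreducible
  varieties, fibre-dimension / monodromy arguments) can be STATED, which they cannot for the
  `inf`-defined `R̃`.

`SublevelIrreducible_of` is the kernel-checked composition (no sorry): gap `r'` ↦ eventual bound
`N₁(r')` from the core ↦ level `N ≥ N₁` from the uniform rate ↦ `Z_r = X_{N,r'}` as SETS
(`⊆` by the rate, `⊇` by `R̃(T) ≤ R(T^{⊠N})^{1/N} < r'` and the gap) ↦ primality.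

Disproof used: `sublevelIrreducible_false_without_nonneg` (refuter CruxAttack.lean: dropping
`0 ≤ r` makes the crux false at `r = -1`) — honoured: the composition only ever instantiates the
core at `s = r' > r ≥ 0`, and for `r < 0` the hypothesis `0 ≤ r` of the crux is what makes
`0 < r'` available; no stub asserts anything about empty sublevel sets.
-/

namespace Summit.MatrixMultiplication.MatrixMultiplication.Cruxes.SublevelIrreducible.Birth

open Literature.Computability.AlgebraicComplexity

noncomputable section

/-- **Stub 1 (value gap / well-ordering of asymptotic-rank values; provable).**  On a fixed
format `a × b × c` over `ℂ`, above every real `r` there is `r' > r` such that no tensor has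
asymptotic rank in the open interval `(r, r')`: every `T` has `R̃(T) ≤ r` or `R̃(T) ≥ r'`.
(If no value exceeds `r`, any `r' > r` works; otherwise `r'` is the least value `> r`, which
exists because a strictly decreasing sequence of values would give a strictly increasing chain of
vanishing ideals `I(Z_{v₁}) ⊊ I(Z_{v₂}) ⊊ ⋯` in the Noetherian ring `ℂ[x_{ijk}]`, strictness by
CHNVZ Thm 1.2 in tree.) -/
theorem stub_valueGap :
    ∀ (a b c : ℕ) (r : ℝ), ∃ r' : ℝ, r < r' ∧
      ∀ T : Fin a → Fin b → Fin c → ℂ, asymptoticRank T ≤ r ∨ r' ≤ asymptoticRank T := by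
  sorry

/-- **Stub 2 (uniform rate on a sublevel set; provable).**  For `r < r'` and any `N₁` there is a
single exponent `N ≥ N₁`, `N ≥ 1`, such that EVERY tensor of the format with `R̃(T) ≤ r` has
`R(T^{⊠N}) < r'^N` — the CHNVZ Thm 2.2 double-blocking estimate is uniform in `T ∈ Z_r` because
the spanning tensors of `span Z_r^{⊠n}` are fixed once `n` is. -/
theorem stub_uniformRate :
    ∀ (a b c : ℕ) (r r' : ℝ) (N₁ : ℕ), r < r' →
      ∃ N : ℕ, N₁ ≤ N ∧ 1 ≤ N ∧
        ∀ T : Fin a → Fin b → Fin c → ℂ, asymptoticRank T ≤ r →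
          (tensorRank (kroneckerPow T N) : ℝ) < r' ^ N := by
  sorry

/-- **Stub 3 (OPEN core: eventual primality of the power-rank loci).**  For every format and
every threshold base `s > 0`, for all sufficiently large `N` the vanishing ideal of the
rank-sublevel locus of the `N`-th Kronecker power map,
`X_{N,s} = {x ∈ ℂ^{a×b×c} : R(x^{⊠N}) < s^N}`, is prime.  (`N = 1`: secant varieties.  It is the
crux transferred to a finite level: `X_{N,s}` is the image of the incidence variety of
`k`-term decompositions of `N`-th powers, `k = ⌈s^N⌉ - 1`.) -/
theorem stub_powerRankLocusPrime :
    ∀ (a b c : ℕ) (s : ℝ), 0 < s → ∃ N₁ : ℕ, ∀ N : ℕ, N₁ ≤ N →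
      (MvPolynomial.vanishingIdeal ℂ
        {x : Fin a × Fin b × Fin c → ℂ |
          (tensorRank (kroneckerPow (fun (i : Fin a) (j : Fin b) (k : Fin c) => x (i, j, k)) N)
            : ℝ) < s ^ N}).IsPrime := by
  sorry

/-- Root extraction from one power (sorry-free helper for the composition): if `N ≥ 1` and
`R(T^{⊠N}) < s^N` with `s ≥ 0` then `R̃(T) < s`, since `R̃(T)` is the infimum of the
`R(T^{⊠M})^{1/M}`. -/
theorem asymptoticRank_lt_of_tensorRank_kroneckerPow_lt {ι κ μ : Type} [Fintype ι] [Fintype κ]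
    [Fintype μ] {T : ι → κ → μ → ℂ} {N : ℕ} (hN : 1 ≤ N) {s : ℝ} (hs : 0 ≤ s)
    (h : (tensorRank (kroneckerPow T N) : ℝ) < s ^ N) : asymptoticRank T < s := by
  have h0 : (0 : ℝ) ≤ (tensorRank (kroneckerPow T N) : ℝ) := Nat.cast_nonneg _
  have hNne : N ≠ 0 := by omega
  have hle : asymptoticRank T ≤ ((tensorRank (kroneckerPow T N) : ℝ)) ^ ((N : ℝ))⁻¹ := by
    unfold asymptoticRank
    have hb : BddBelow (Set.range fun M : ℕ =>
        ((tensorRank (kroneckerPow T (M + 1)) : ℝ) ^ ((M : ℝ) + 1)⁻¹)) :=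
      ⟨0, by rintro _ ⟨M, rfl⟩; positivity⟩
    refine (ciInf_le hb (N - 1)).trans_eq ?_
    have hsub : N - 1 + 1 = N := Nat.sub_add_cancel hN
    have hcast : ((N - 1 : ℕ) : ℝ) + 1 = ((N : ℕ) : ℝ) := by exact_mod_cast hsub
    rw [hcast, hsub]
  calc asymptoticRank T ≤ ((tensorRank (kroneckerPow T N) : ℝ)) ^ ((N : ℝ))⁻¹ := hle
    _ < (s ^ N) ^ ((N : ℝ))⁻¹ := Real.rpow_lt_rpow h0 h (by positivity)
    _ = s := Real.pow_rpow_inv_natCast hs hNne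

/-- **Composition (kernel-checked, no sorry): the three stubs imply the crux BY NAME.**
Given `0 ≤ r`: take the gap `r' > r` (stub 1), the eventual bound `N₁` of the core at `s = r'`
(stub 3, `0 < r'`), and a level `N ≥ N₁` of uniform rate (stub 2).  Then as sets
`{R̃ ≤ r} = {R(·^{⊠N}) < r'^N}` — `⊆` is the rate; `⊇`: `R(T^{⊠N}) < r'^N` gives `R̃(T) < r'`,
and the gap forces `R̃(T) ≤ r` — so the vanishing ideal of the sublevel set is that of the
power-rank locus, prime by the core. -/
theorem SublevelIrreducible_of :
    (∀ (a b c : ℕ) (r : ℝ), ∃ r' : ℝ, r < r' ∧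
      ∀ T : Fin a → Fin b → Fin c → ℂ, asymptoticRank T ≤ r ∨ r' ≤ asymptoticRank T) →
    (∀ (a b c : ℕ) (r r' : ℝ) (N₁ : ℕ), r < r' →
      ∃ N : ℕ, N₁ ≤ N ∧ 1 ≤ N ∧
        ∀ T : Fin a → Fin b → Fin c → ℂ, asymptoticRank T ≤ r →
          (tensorRank (kroneckerPow T N) : ℝ) < r' ^ N) →
    (∀ (a b c : ℕ) (s : ℝ), 0 < s → ∃ N₁ : ℕ, ∀ N : ℕ, N₁ ≤ N →
      (MvPolynomial.vanishingIdeal ℂ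
        {x : Fin a × Fin b × Fin c → ℂ |
          (tensorRank (kroneckerPow (fun (i : Fin a) (j : Fin b) (k : Fin c) => x (i, j, k)) N)
            : ℝ) < s ^ N}).IsPrime) →
    Summit.MatrixMultiplication.MatrixMultiplication.Theses.IrreducibleSublevelSets.SublevelIrreducible := by
  intro h1 h2 h3 a b c r hr
  obtain ⟨r', hrr', hgap⟩ := h1 a b c r
  have hr'pos : 0 < r' := lt_of_le_of_lt hr hrr'
  obtain ⟨N₁, hN₁⟩ := h3 a b c r' hr'pos
  obtain ⟨N, hNN₁, hN1, hrate⟩ := h2 a b c r r' N₁ hrr'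
  have hset :
      {x : Fin a × Fin b × Fin c → ℂ |
          asymptoticRank (fun (i : Fin a) (j : Fin b) (k : Fin c) => x (i, j, k)) ≤ r} =
        {x : Fin a × Fin b × Fin c → ℂ |
          (tensorRank (kroneckerPow (fun (i : Fin a) (j : Fin b) (k : Fin c) => x (i, j, k)) N)
            : ℝ) < r' ^ N} := by
    ext x
    simp only [Set.mem_setOf_eq]
    constructor
    · intro hx
      exact hrate _ hx
    · intro hx
      rcases hgap (fun i j k => x (i, j, k)) with h | h
      · exact h
      · exact absurd h (not_le.mpr
          (asymptoticRank_lt_of_tensorRank_kroneckerPow_lt hN1 hr'pos.le hx))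
  show (MvPolynomial.vanishingIdeal ℂ
    {x : Fin a × Fin b × Fin c → ℂ |
      asymptoticRank (fun (i : Fin a) (j : Fin b) (k : Fin c) => x (i, j, k)) ≤ r}).IsPrime
  rw [hset]
  exact hN₁ N hNN₁

/-- The same composition with the registered stubs plugged in (the line's end-to-end shape;
its only sorries are the three `stub_*`). -/
theorem SublevelIrreducible_of_stubs :
    Summit.MatrixMultiplication.MatrixMultiplication.Theses.IrreducibleSublevelSets.SublevelIrreducible :=
  SublevelIrreducible_of stub_valueGap stub_uniformRate stub_powerRankLocusPrime

end

end Summit.MatrixMultiplication.MatrixMultiplication.Cruxes.SublevelIrreducible.Birth
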